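import Summits.ValiantsHypothesis.ValiantsHypothesis.Theorems.LacunarySymmetroidMatrixDescartesFiniteSectorSectorCeilingTwelveFiveA
import Summits.ValiantsHypothesis.ValiantsHypothesis.Theorems.LacunarySymmetroidMatrixDescartesFiniteSectorSectorCeilingTwelveFiveB
import Summits.ValiantsHypothesis.ValiantsHypothesis.Theorems.LacunarySymmetroidMatrixDescartesFiniteSectorSectorCeilingTwelveFiveC
import Summits.ValiantsHypothesis.ValiantsHypothesis.Theorems.LacunarySymmetroidMatrixDescartesFiniteSectorSectorCeilingTwelveFiveD
import Summits.ValiantsHypothesis.ValiantsHypothesis.Theorems.LacunarySymmetroidMatrixDescartesFiniteSectorSectorCeilingTwelveFiveE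
import Summits.ValiantsHypothesis.ValiantsHypothesis.Theorems.LacunarySymmetroidMatrixDescartesFiniteSectorSectorCeilingTwelveFiveF
import Summits.ValiantsHypothesis.ValiantsHypothesis.Theorems.LacunarySymmetroidMatrixDescartesFiniteSectorSectorCeilingTwelveFiveG
import Summits.ValiantsHypothesis.ValiantsHypothesis.Theorems.LacunarySymmetroidMatrixDescartesFiniteSectorSectorCeilingTwelveFiveH
import Summits.ValiantsHypothesis.ValiantsHypothesis.Theorems.LacunarySymmetroidMatrixDescartesFiniteSectorSectorCeilingTwelveFiveI
import Summits.ValiantsHypothesis.ValiantsHypothesis.Theorems.LacunarySymmetroidMatrixDescartesFiniteSectorSectorCeilingTwelveFiveJ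
import Summits.ValiantsHypothesis.ValiantsHypothesis.Theorems.LacunarySymmetroidMatrixDescartesFiniteSectorSectorCeilingTwelveFiveK
import Summits.ValiantsHypothesis.ValiantsHypothesis.Theorems.LacunarySymmetroidMatrixDescartesFiniteSectorSectorCeilingTwelveFiveL
import Summits.ValiantsHypothesis.ValiantsHypothesis.Theorems.LacunarySymmetroidMatrixDescartesFiniteSectorSectorCeilingTwelveFiveM
import Summits.ValiantsHypothesis.ValiantsHypothesis.Theorems.LacunarySymmetroidMatrixDescartesFiniteSectorSectorCeilingTwelveFiveN
import Summits.ValiantsHypothesis.ValiantsHypothesis.Theorems.LacunarySymmetroidMatrixDescartesFiniteSectorSectorCeilingTwelveFiveO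
import Summits.ValiantsHypothesis.ValiantsHypothesis.Theorems.LacunarySymmetroidMatrixDescartesFiniteSectorSectorCeilingTwelveFiveP
import Summits.ValiantsHypothesis.ValiantsHypothesis.Theorems.LacunarySymmetroidMatrixDescartesFiniteSectorSectorCeilingTwelveFiveQ
import Summits.ValiantsHypothesis.ValiantsHypothesis.Theorems.LacunarySymmetroidMatrixDescartesFiniteSectorSectorCeilingTwelveFiveR
import Summits.ValiantsHypothesis.ValiantsHypothesis.Theorems.LacunarySymmetroidMatrixDescartesFiniteSectorSectorCeilingTwelveFiveS
import Summits.ValiantsHypothesis.ValiantsHypothesis.Theorems.LacunarySymmetroidMatrixDescartesFiniteSectorSectorCeilingTwelveFiveT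
import Summits.ValiantsHypothesis.ValiantsHypothesis.Theorems.LacunarySymmetroidMatrixDescartesFiniteSectorSectorCeilingTwelveFiveU
import Summits.ValiantsHypothesis.ValiantsHypothesis.Theorems.LacunarySymmetroidMatrixDescartesFiniteSectorSectorCeilingTwelveFiveV
import Summits.ValiantsHypothesis.ValiantsHypothesis.Theorems.LacunarySymmetroidMatrixDescartesFiniteSectorSectorCeilingTwelveFiveW
import Summits.ValiantsHypothesis.ValiantsHypothesis.Theorems.LacunarySymmetroidMatrixDescartesFiniteSectorSectorCeilingTwelveFiveX
import Summits.ValiantsHypothesis.ValiantsHypothesis.Theorems.LacunarySymmetroidMatrixDescartesFiniteSectorSumMasksHigherFive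

/-!
# `MatrixDescartes` — line «finite»: the SECTOR CEILING `η(12,5) ≤ σ(12,5) = 1416` (kernel) — `HypRootLawAt 12 5 1416`, Conjecture Σ's value
# `2·n(12,4)` at the cell `(12,5)`

HONEST FRAMING.  Object-search cell `pub-symmetroid`, seat val-sym-door-p5 g10 (generators of val-sym-door-p5 g8/g9 VERBATIM, m-tables extended to m ≤ 19; fold binders typed `(x acc : ℕ)` — same elaborated terms, fast elaboration).  HELPER of the crux item `stmt-ValiantsHypothesis-18050` with NO closure claim.  The SIEVE of
line «finite» (`FiniteSector.sieve`, `natDegree_mem_sumset`) makes the `12`-fold sums of exponents of an in-sector pencil a step-≤-2 chain from `0` up to the degree;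
the finite core — no `4` positive values carry such a chain beyond `1416` — has 392515 live prefixes and is decided in the kernel in SLICES by the two smallest positive
values `(a,b)` (`a ≤ 2` and `b ≤ 12a + 2` are forced by the chain at `r = 1` and `r = 12a + 1`): slices (1,2), (1,3), (1,4), (1,5), (1,6), (1,7), (1,8), (1,9), (1,10), (1,11), (1,12), (1,13), (1,14), (2,3), (2,4), (2,5), (2,6), (2,7), (2,8), (2,9), (2,10), (2,11), (2,12), (2,13), (2,14), (2,15), (2,16), (2,17), (2,18), (2,19), (2,20), (2,21), (2,22), (2,23), (2,24), (2,25), (2,26) in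
`…FiniteSectorSectorCeilingTwelveFiveA`, `…FiniteSectorSectorCeilingTwelveFiveB`, `…FiniteSectorSectorCeilingTwelveFiveC`, `…FiniteSectorSectorCeilingTwelveFiveD`, `…FiniteSectorSectorCeilingTwelveFiveE`, `…FiniteSectorSectorCeilingTwelveFiveF`, `…FiniteSectorSectorCeilingTwelveFiveG`, `…FiniteSectorSectorCeilingTwelveFiveH`, `…FiniteSectorSectorCeilingTwelveFiveI`, `…FiniteSectorSectorCeilingTwelveFiveJ`, `…FiniteSectorSectorCeilingTwelveFiveK`, `…FiniteSectorSectorCeilingTwelveFiveL`, `…FiniteSectorSectorCeilingTwelveFiveM`, `…FiniteSectorSectorCeilingTwelveFiveN`, `…FiniteSectorSectorCeilingTwelveFiveO`, `…FiniteSectorSectorCeilingTwelveFiveP`, `…FiniteSectorSectorCeilingTwelveFiveQ`, `…FiniteSectorSectorCeilingTwelveFiveR`, `…FiniteSectorSectorCeilingTwelveFiveS`, `…FiniteSectorSectorCeilingTwelveFiveT`, `…FiniteSectorSectorCeilingTwelveFiveU`, `…FiniteSectorSectorCeilingTwelveFiveV`, `…FiniteSectorSectorCeilingTwelveFiveW`,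 `…FiniteSectorSectorCeilingTwelveFiveX` (this file holds the transfer only); `12`-fold sums as iterated shift-form
bitmasks (`…FiniteSectorSumMasksHigher`).  Result: `hypRootLawAt_twelve_five_1416 : HypRootLawAt 12 5 1416`.  Located first (exact DFS, this seat, HOME/val-sym-door-p5/g9/work/mask/slice_count_m.py):
the chain survives to `1415` only on the doubled extremal basis `2·{0,1,7,48,126}` — `σ(12,5) = 1416 = 2·n(12,4)`, Conjecture Σ of `Lines/finite.md` at the NEW cell `(12,5)`; the lower
side needs a realised doubled basis and is NOT claimed here.  Nothing here bears on the crux (asymptotic), on `H3`, on the doors, or on `VP ≠ VNP`.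
[folklore] Gap-rule / sieve bookkeeping plus a finite enumeration (postage-stamp numbers); no citation is load-bearing.
-/

-- `Summit.ValiantsHypothesis.ValiantsHypothesis.…` repeats a component by the D-0017 layout
-- (single-conjunct summit), which the `dupNamespace` linter flags; the name is mandated.
set_option linter.dupNamespace false

namespace Summit.ValiantsHypothesis.ValiantsHypothesis.Theorems.LacunarySymmetroidMatrixDescartes.FiniteSector

open scoped BigOperators Matrix
open Polynomial

/-! ## `(12,5)`: `σ(12,5) = 1416` — the transfer -/


set_option maxRecDepth 4000 in
set_option maxHeartbeats 4000000 in
/-- **`η(12,5) ≤ 1416 = σ(12,5)`** — `HypRootLawAt 12 5 1416`: every in-sector (`#distinct real roots = natDegree`) determinant of a real symmetric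
`12 × 12` lacunary pencil with `5` terms has degree `≤ 1416` (SIEVE ⇒ `12`-fold-sum chain; values capped at `1419`, padded, sorted; `a ≤ 2`, `b ≤ 12a + 2`;
prefix pruning; bitmasks; the slice checks). [folklore] -/
theorem hypRootLawAt_twelve_five_1416 : HypRootLawAt 12 5 1416 := by
  intro d S hS hsec
  by_contra hdeg'
  have hdeg : 1416 < (pencil d S).det.natDegree := not_le.mp hdeg'
  have hq : (pencil d S).det ≠ 0 := by
    intro h0
    rw [h0] at hdeg
    simp at hdeg
  have hpair : ∀ r, r ∈ (Finset.univ : Finset (Sym (Fin 5) 12)).image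
      (fun s : Sym (Fin 5) 12 => ((s : Multiset (Fin 5)).map d).sum) → ∃ i j k l n o q i₁ j₁ k₁ l₁ n₁ : Fin 5, d i + d j + d k + d l + d n + d o + d q + d i₁ + d j₁ + d k₁ + d l₁ + d n₁ = r := by
    intro r hr
    rw [Finset.mem_image] at hr
    obtain ⟨s, -, hs⟩ := hr
    obtain ⟨i, j, k, l, n, o, q, i₁, j₁, k₁, l₁, n₁, h12⟩ := exists_sum_eq_of_card_twelve d (s : Multiset (Fin 5)) s.2
    exact ⟨i, j, k, l, n, o, q, i₁, j₁, k₁, l₁, n₁, by omega⟩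
  have hchain : ∀ r, r + 2 ≤ (pencil d S).det.natDegree →
      (∃ i j k l n o q i₁ j₁ k₁ l₁ n₁ : Fin 5, d i + d j + d k + d l + d n + d o + d q + d i₁ + d j₁ + d k₁ + d l₁ + d n₁ = r) ∨ (∃ i j k l n o q i₁ j₁ k₁ l₁ n₁ : Fin 5, d i + d j + d k + d l + d n + d o + d q + d i₁ + d j₁ + d k₁ + d l₁ + d n₁ = r + 1) := by
    intro r hr
    rcases sieve d S hq hsec hr with h | h
    · exact Or.inl (hpair _ h)
    · exact Or.inr (hpair _ h)
  have htop : ∃ i j k l n o q i₁ j₁ k₁ l₁ n₁ : Fin 5, d i + d j + d k + d l + d n + d o + d q + d i₁ + d j₁ + d k₁ + d l₁ + d n₁ = (pencil d S).det.natDegree := hpair _ (natDegree_mem_sumset d S hq)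
  set cv : Fin 5 → ℕ := fun i => min (d i) 1419 with hcv
  have hcvd : ∀ i, d i ≤ 1418 → cv i = d i := fun i hi => by
    simp only [hcv]
    exact Nat.min_eq_left (by omega)
  have hcvle : ∀ i, cv i ≤ 1419 := fun i => Nat.min_le_right _ _
  set V : Finset ℕ := Finset.univ.image cv with hV
  have hcvV : ∀ i, cv i ∈ V := fun i => Finset.mem_image_of_mem cv (Finset.mem_univ i)
  have h0V : 0 ∈ V := by
    have key : ∃ i : Fin 5, d i = 0 := by
      rcases hchain 0 (by omega) with ⟨i, j, k, l, n, o, q, i₁, j₁, k₁, l₁, n₁, hh⟩ | ⟨i, j, k, l, n, o, q, i₁, j₁, k₁, l₁, n₁, hh⟩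
      · exact ⟨i, by omega⟩
      · rcases Nat.eq_zero_or_pos (d i) with hi | hi
        · exact ⟨i, hi⟩
        · exact ⟨j, by omega⟩
    obtain ⟨i, hi⟩ := key
    have : cv i = 0 := by rw [hcvd i (by omega)]; omega
    exact this ▸ hcvV i
  set W : Finset ℕ := V.erase 0 with hW
  have hWsub : W ⊆ (Finset.range 1420).erase 0 := by
    intro u hu
    rw [hW, Finset.mem_erase] at hu
    obtain ⟨hu0, huV⟩ := hu
    rw [hV, Finset.mem_image] at huV
    obtain ⟨i, -, rfl⟩ := huV
    rw [Finset.mem_erase, Finset.mem_range]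
    exact ⟨hu0, Nat.lt_succ_of_le (hcvle i)⟩
  have hWcard : W.card ≤ 4 := by
    have hVK : V.card ≤ 5 := by
      have := Finset.card_image_le (s := (Finset.univ : Finset (Fin 5))) (f := cv)
      simpa using this
    have h1 : W.card + 1 = V.card := by rw [hW]; exact Finset.card_erase_add_one h0V
    omega
  obtain ⟨W', hWW', hW'sub, hW'card⟩ := Finset.exists_subsuperset_card_eq hWsub hWcard
    (by rw [Finset.card_erase_of_mem (by simp), Finset.card_range]; omega)
  have hVW' : ∀ u ∈ V, u = 0 ∨ u ∈ W' := by
    intro u hu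
    by_cases hu0 : u = 0
    · exact Or.inl hu0
    · exact Or.inr (hWW' (by rw [hW, Finset.mem_erase]; exact ⟨hu0, hu⟩))
  have hlmem : ∀ u, u ∈ Finset.sort W' ↔ u ∈ W' := fun u => Finset.mem_sort _
  have hlsort : (Finset.sort W').SortedLT := Finset.sortedLT_sort W'
  have hllen : (Finset.sort W').length = 4 := by rw [Finset.length_sort, hW'card]
  generalize hl : Finset.sort W' = l at hlmem hlsort hllen
  rcases l with _ | ⟨a, _ | ⟨b, _ | ⟨c, _ | ⟨e, _ | ⟨zz, ll⟩⟩⟩⟩⟩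
  all_goals simp only [List.length_cons, List.length_nil] at hllen
  all_goals try omega
  have hmemR : ∀ u, u ∈ [a, b, c, e] → u ∈ List.range 1420 := by
    intro u hu
    have hu' : u ∈ W' := (hlmem u).mp hu
    have := hW'sub hu'
    rw [Finset.mem_erase, Finset.mem_range] at this
    exact List.mem_range.mpr this.2
  have hne0 : ∀ u, u ∈ [a, b, c, e] → u ≠ 0 := by
    intro u hu
    have hu' : u ∈ W' := (hlmem u).mp hu
    have := hW'sub hu'
    rw [Finset.mem_erase] at this
    exact this.1
  have h0 : 0 < a := Nat.pos_of_ne_zero (hne0 a (by simp))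
  have hmemP : ∀ r, r ≤ 1418 → (∃ i j k l n o q i₁ j₁ k₁ l₁ n₁ : Fin 5, d i + d j + d k + d l + d n + d o + d q + d i₁ + d j₁ + d k₁ + d l₁ + d n₁ = r) → (∃ x ∈ [0, a, b, c, e], ∃ y ∈ [0, a, b, c, e], ∃ z ∈ [0, a, b, c, e], ∃ w ∈ [0, a, b, c, e], ∃ v ∈ [0, a, b, c, e], ∃ o ∈ [0, a, b, c, e], ∃ t ∈ [0, a, b, c, e], ∃ e₁ ∈ [0, a, b, c, e], ∃ e₂ ∈ [0, a, b, c, e], ∃ e₃ ∈ [0, a, b, c, e], ∃ e₄ ∈ [0, a, b, c, e], ∃ e₅ ∈ [0, a, b, c, e], x + y + z + w + v + o + t + e₁ + e₂ + e₃ + e₄ + e₅ = r) := by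
    rintro r hr ⟨i, j, k, l, n, o, q, i₁, j₁, k₁, l₁, n₁, hsum⟩
    have hi : cv i = d i := hcvd i (by omega)
    have hj : cv j = d j := hcvd j (by omega)
    have hk : cv k = d k := hcvd k (by omega)
    have hl : cv l = d l := hcvd l (by omega)
    have hn : cv n = d n := hcvd n (by omega)
    have ho : cv o = d o := hcvd o (by omega)
    have hq : cv q = d q := hcvd q (by omega)
    have hi₁ : cv i₁ = d i₁ := hcvd i₁ (by omega)
    have hj₁ : cv j₁ = d j₁ := hcvd j₁ (by omega)
    have hk₁ : cv k₁ = d k₁ := hcvd k₁ (by omega)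
    have hl₁ : cv l₁ = d l₁ := hcvd l₁ (by omega)
    have hn₁ : cv n₁ = d n₁ := hcvd n₁ (by omega)
    have hin : ∀ u ∈ V, u ∈ [0, a, b, c, e] := by
      intro u hu
      rcases hVW' u hu with h | h
      · rw [h]; simp
      · exact List.mem_cons_of_mem _ ((hlmem u).mpr h)
    exact ⟨cv i, hin _ (hcvV i), cv j, hin _ (hcvV j), cv k, hin _ (hcvV k), cv l, hin _ (hcvV l), cv n, hin _ (hcvV n), cv o, hin _ (hcvV o), cv q, hin _ (hcvV q), cv i₁, hin _ (hcvV i₁), cv j₁, hin _ (hcvV j₁), cv k₁, hin _ (hcvV k₁), cv l₁, hin _ (hcvV l₁), cv n₁, hin _ (hcvV n₁), by rw [hi, hj, hk, hl, hn, ho, hq, hi₁, hj₁, hk₁, hl₁, hn₁]; exact hsum⟩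
  have hchainP : ∀ r, r ≤ 1415 → (∃ x ∈ [0, a, b, c, e], ∃ y ∈ [0, a, b, c, e], ∃ z ∈ [0, a, b, c, e], ∃ w ∈ [0, a, b, c, e], ∃ v ∈ [0, a, b, c, e], ∃ o ∈ [0, a, b, c, e], ∃ t ∈ [0, a, b, c, e], ∃ e₁ ∈ [0, a, b, c, e], ∃ e₂ ∈ [0, a, b, c, e], ∃ e₃ ∈ [0, a, b, c, e], ∃ e₄ ∈ [0, a, b, c, e], ∃ e₅ ∈ [0, a, b, c, e], x + y + z + w + v + o + t + e₁ + e₂ + e₃ + e₄ + e₅ = r) ∨ (∃ x ∈ [0, a, b, c, e], ∃ y ∈ [0, a, b, c, e], ∃ z ∈ [0, a, b, c, e], ∃ w ∈ [0, a, b, c, e], ∃ v ∈ [0, a, b, c, e], ∃ o ∈ [0, a, b, c, e], ∃ t ∈ [0, a, b, c, e], ∃ e₁ ∈ [0, a, b, c, e], ∃ e₂ ∈ [0, a, b, c, e], ∃ e₃ ∈ [0, a, b, c, e], ∃ e₄ ∈ [0, a, b, c, e], ∃ e₅ ∈ [0, a, b, c, e], x + y + z + w + v + o + t + e₁ + e₂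 + e₃ + e₄ + e₅ = r + 1) := by
    intro r hr
    rcases hchain r (by omega) with h | h
    · exact Or.inl (hmemP r (by clear h; omega) h)
    · exact Or.inr (hmemP (r + 1) (by clear h; omega) h)
  have hfull : ((List.foldr (fun (x acc : ℕ) => acc ||| (List.foldr (fun (x acc : ℕ) => acc ||| (List.foldr (fun (x acc : ℕ) => acc ||| (List.foldr (fun (x acc : ℕ) => acc ||| (List.foldr (fun (x acc : ℕ) => acc ||| (List.foldr (fun (x acc : ℕ) => acc ||| (List.foldr (fun (x acc : ℕ) => acc ||| (List.foldr (fun (x acc : ℕ) => acc ||| (List.foldr (fun (x acc : ℕ) => acc ||| (List.foldr (fun (x acc : ℕ) => acc ||| (List.foldr (fun (x acc : ℕ) => acc ||| (List.foldr (fun (y acc : ℕ) => acc ||| 2 ^ y) 0 [0, a, b, c, e]) * 2 ^ x) 0 [0, a, b, c, e]) * 2 ^ x) 0 [0, a, b, c, e]) * 2 ^ x) 0 [0, a, b, c, e]) * 2 ^ x) 0 [0, a, b, c, e]) * 2 ^ x) 0 [0, a, b, c, e]) * 2 ^ x) 0 [0, a, b, c, e]) * 2 ^ x) 0 [0, a,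 b, c, e]) * 2 ^ x) 0 [0, a, b, c, e]) * 2 ^ x) 0 [0, a, b, c, e]) * 2 ^ x) 0 [0, a, b, c, e]) * 2 ^ x) 0 [0, a, b, c, e] ||| List.foldr (fun (x acc : ℕ) => acc ||| (List.foldr (fun (x acc : ℕ) => acc ||| (List.foldr (fun (x acc : ℕ) => acc ||| (List.foldr (fun (x acc : ℕ) => acc ||| (List.foldr (fun (x acc : ℕ) => acc ||| (List.foldr (fun (x acc : ℕ) => acc ||| (List.foldr (fun (x acc : ℕ) => acc ||| (List.foldr (fun (x acc : ℕ) => acc ||| (List.foldr (fun (x acc : ℕ) => acc ||| (List.foldr (fun (x acc : ℕ) => acc ||| (List.foldr (fun (x acc : ℕ) => acc ||| (List.foldr (fun (y acc : ℕ) => acc ||| 2 ^ y) 0 [0, a, b, c, e]) * 2 ^ x) 0 [0, a, b, c, e]) * 2 ^ x) 0 [0, a, b, c, e]) * 2 ^ x) 0 [0, a, b, c, e]) * 2 ^ x) 0 [0, a, b, c, e]) * 2 ^ x) 0 [0, a, b, c, e]) * 2 ^ x) 0 [0, a, b, c, e]) * 2 ^ x) 0 [0, a, b, c, e]) * 2 ^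 x) 0 [0, a, b, c, e]) * 2 ^ x) 0 [0, a, b, c, e]) * 2 ^ x) 0 [0, a, b, c, e]) * 2 ^ x) 0 [0, a, b, c, e] / 2) % 2 ^ 1416 = 2 ^ 1416 - 1) := by
    apply maskAlive_of_testBit
    intro r hr
    rcases hchainP r (by omega) with h | h
    · exact Or.inl (testBit_fold12Shift_of_mem h)
    · exact Or.inr (testBit_fold12Shift_of_mem h)
  have hlt1 : a < b := by
    have := hlsort (show (⟨0, by simp⟩ : Fin [a, b, c, e].length) < ⟨1, by simp⟩ from Fin.mk_lt_mk.mpr (by norm_num))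
    simpa using this
  have hlt2 : b < c := by
    have := hlsort (show (⟨1, by simp⟩ : Fin [a, b, c, e].length) < ⟨2, by simp⟩ from Fin.mk_lt_mk.mpr (by norm_num))
    simpa using this
  have hlt3 : c < e := by
    have := hlsort (show (⟨2, by simp⟩ : Fin [a, b, c, e].length) < ⟨3, by simp⟩ from Fin.mk_lt_mk.mpr (by norm_num))
    simpa using this
  -- the two smallest positive values: `a ≤ 2` (chain at `1`) and `b ≤ 12a + 2` (chain at `12a + 1`)
  have hrestA : ∀ y ∈ [a, b, c, e], a ≤ y := by
    clear hfull
    intro y hy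
    simp only [List.mem_cons, List.mem_nil_iff, or_false] at hy
    omega
  have hrestB : ∀ y ∈ [b, c, e], b ≤ y := by
    clear hfull
    intro y hy
    simp only [List.mem_cons, List.mem_nil_iff, or_false] at hy
    omega
  have ha2 : a ≤ 2 := by
    clear hfull
    by_contra hh
    rcases hchainP 1 (by omega) with h | h
    · obtain ⟨x, hx, y, hy, z, hz, w, hw, v, hv, o, ho, t, ht, e₁, he₁, e₂, he₂, e₃, he₃, e₄, he₄, e₅, he₅, hsum⟩ := memP12_prefix (l₁ := [0]) (l₂ := [a, b, c, e]) hrestA (by omega) h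
      simp only [List.mem_cons, List.mem_nil_iff, or_false] at hx hy hz hw hv ho ht he₁ he₂ he₃ he₄ he₅
      omega
    · obtain ⟨x, hx, y, hy, z, hz, w, hw, v, hv, o, ho, t, ht, e₁, he₁, e₂, he₂, e₃, he₃, e₄, he₄, e₅, he₅, hsum⟩ := memP12_prefix (l₁ := [0]) (l₂ := [a, b, c, e]) hrestA (by omega) h
      simp only [List.mem_cons, List.mem_nil_iff, or_false] at hx hy hz hw hv ho ht he₁ he₂ he₃ he₄ he₅
      omega
  have hb2 : b ≤ 12 * a + 2 := by
    clear hfull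
    by_contra hh
    rcases hchainP (12 * a + 1) (by omega) with h | h
    · obtain ⟨x, hx, y, hy, z, hz, w, hw, v, hv, o, ho, t, ht, e₁, he₁, e₂, he₂, e₃, he₃, e₄, he₄, e₅, he₅, hsum⟩ := memP12_prefix (l₁ := [0, a]) (l₂ := [b, c, e]) hrestB (by omega) h
      simp only [List.mem_cons, List.mem_nil_iff, or_false] at hx hy hz hw hv ho ht he₁ he₂ he₃ he₄ he₅
      have hx' : x ≤ a := by rcases hx with hh0 | hh0 <;> omega
      have hy' : y ≤ a := by rcases hy with hh0 | hh0 <;> omega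
      have hz' : z ≤ a := by rcases hz with hh0 | hh0 <;> omega
      have hw' : w ≤ a := by rcases hw with hh0 | hh0 <;> omega
      have hv' : v ≤ a := by rcases hv with hh0 | hh0 <;> omega
      have ho' : o ≤ a := by rcases ho with hh0 | hh0 <;> omega
      have ht' : t ≤ a := by rcases ht with hh0 | hh0 <;> omega
      have he₁' : e₁ ≤ a := by rcases he₁ with hh0 | hh0 <;> omega
      have he₂' : e₂ ≤ a := by rcases he₂ with hh0 | hh0 <;> omega
      have he₃' : e₃ ≤ a := by rcases he₃ with hh0 | hh0 <;> omega
      have he₄' : e₄ ≤ a := by rcases he₄ with hh0 | hh0 <;> omega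
      have he₅' : e₅ ≤ a := by rcases he₅ with hh0 | hh0 <;> omega
      clear hx hy hz hw hv ho ht he₁ he₂ he₃ he₄ he₅
      omega
    · obtain ⟨x, hx, y, hy, z, hz, w, hw, v, hv, o, ho, t, ht, e₁, he₁, e₂, he₂, e₃, he₃, e₄, he₄, e₅, he₅, hsum⟩ := memP12_prefix (l₁ := [0, a]) (l₂ := [b, c, e]) hrestB (by omega) h
      simp only [List.mem_cons, List.mem_nil_iff, or_false] at hx hy hz hw hv ho ht he₁ he₂ he₃ he₄ he₅
      have hx' : x ≤ a := by rcases hx with hh0 | hh0 <;> omega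
      have hy' : y ≤ a := by rcases hy with hh0 | hh0 <;> omega
      have hz' : z ≤ a := by rcases hz with hh0 | hh0 <;> omega
      have hw' : w ≤ a := by rcases hw with hh0 | hh0 <;> omega
      have hv' : v ≤ a := by rcases hv with hh0 | hh0 <;> omega
      have ho' : o ≤ a := by rcases ho with hh0 | hh0 <;> omega
      have ht' : t ≤ a := by rcases ht with hh0 | hh0 <;> omega
      have he₁' : e₁ ≤ a := by rcases he₁ with hh0 | hh0 <;> omega
      have he₂' : e₂ ≤ a := by rcases he₂ with hh0 | hh0 <;> omega
      have he₃' : e₃ ≤ a := by rcases he₃ with hh0 | hh0 <;> omega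
      have he₄' : e₄ ≤ a := by rcases he₄ with hh0 | hh0 <;> omega
      have he₅' : e₅ ≤ a := by rcases he₅ with hh0 | hh0 <;> omega
      clear hx hy hz hw hv ho ht he₁ he₂ he₃ he₄ he₅
      omega
  have pre3 : ((List.foldr (fun (x acc : ℕ) => acc ||| (List.foldr (fun (x acc : ℕ) => acc ||| (List.foldr (fun (x acc : ℕ) => acc ||| (List.foldr (fun (x acc : ℕ) => acc ||| (List.foldr (fun (x acc : ℕ) => acc ||| (List.foldr (fun (x acc : ℕ) => acc ||| (List.foldr (fun (x acc : ℕ) => acc ||| (List.foldr (fun (x acc : ℕ) => acc ||| (List.foldr (fun (x acc : ℕ) => acc ||| (List.foldr (fun (x acc : ℕ) => acc ||| (List.foldr (fun (x acc : ℕ) => acc ||| (List.foldr (fun (y acc : ℕ) => acc ||| 2 ^ y) 0 [0, a, b]) * 2 ^ x) 0 [0, a, b]) * 2 ^ x) 0 [0, a, b]) * 2 ^ x) 0 [0, a, b]) * 2 ^ x) 0 [0, a, b]) * 2 ^ x) 0 [0, a, b]) * 2 ^ x) 0 [0, a, b]) * 2 ^ x) 0 [0, a, b]) * 2 ^ x)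 0 [0, a, b]) * 2 ^ x) 0 [0, a, b]) * 2 ^ x) 0 [0, a, b]) * 2 ^ x) 0 [0, a, b] ||| List.foldr (fun (x acc : ℕ) => acc ||| (List.foldr (fun (x acc : ℕ) => acc ||| (List.foldr (fun (x acc : ℕ) => acc ||| (List.foldr (fun (x acc : ℕ) => acc ||| (List.foldr (fun (x acc : ℕ) => acc ||| (List.foldr (fun (x acc : ℕ) => acc ||| (List.foldr (fun (x acc : ℕ) => acc ||| (List.foldr (fun (x acc : ℕ) => acc ||| (List.foldr (fun (x acc : ℕ) => acc ||| (List.foldr (fun (x acc : ℕ) => acc ||| (List.foldr (fun (x acc : ℕ) => acc ||| (List.foldr (fun (y acc : ℕ) => acc ||| 2 ^ y) 0 [0, a, b]) * 2 ^ x) 0 [0, a, b]) * 2 ^ x) 0 [0, a, b]) * 2 ^ x) 0 [0, a, b]) * 2 ^ x) 0 [0, a, b]) * 2 ^ x) 0 [0, a, b]) * 2 ^ x) 0 [0, a, b]) * 2 ^ x) 0 [0, a, b]) * 2 ^ x) 0 [0, a, b]) * 2 ^ x) 0 [0, a, b]) * 2 ^ x) 0 [0, a, b]) * 2 ^ x)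 0 [0, a, b] / 2) % 2 ^ (min 1416 (c - 1)) = 2 ^ (min 1416 (c - 1)) - 1) := by
    clear hfull
    apply maskAlive_of_testBit
    intro r hr
    have hrT : r < 1416 := lt_of_lt_of_le hr (min_le_left _ _)
    have hrv : r < c - 1 := lt_of_lt_of_le hr (min_le_right _ _)
    have hr' : r + 1 < c := by omega
    have hrest : ∀ y ∈ [c, e], c ≤ y := by
      intro y hy
      simp only [List.mem_cons, List.mem_nil_iff, or_false] at hy
      omega
    rcases hchainP r (by omega) with h | h
    · exact Or.inl (testBit_fold12Shift_of_mem (memP12_prefix (l₁ := [0, a, b]) (l₂ := [c, e]) hrest (by omega) h))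
    · exact Or.inr (testBit_fold12Shift_of_mem (memP12_prefix (l₁ := [0, a, b]) (l₂ := [c, e]) hrest hr' h))
  have pre4 : ((List.foldr (fun (x acc : ℕ) => acc ||| (List.foldr (fun (x acc : ℕ) => acc ||| (List.foldr (fun (x acc : ℕ) => acc ||| (List.foldr (fun (x acc : ℕ) => acc ||| (List.foldr (fun (x acc : ℕ) => acc ||| (List.foldr (fun (x acc : ℕ) => acc ||| (List.foldr (fun (x acc : ℕ) => acc ||| (List.foldr (fun (x acc : ℕ) => acc ||| (List.foldr (fun (x acc : ℕ) => acc ||| (List.foldr (fun (x acc : ℕ) => acc ||| (List.foldr (fun (x acc : ℕ) => acc ||| (List.foldr (fun (y acc : ℕ) => acc ||| 2 ^ y) 0 [0, a, b, c]) * 2 ^ x) 0 [0, a, b, c]) * 2 ^ x) 0 [0, a, b, c]) * 2 ^ x) 0 [0, a, b, c]) * 2 ^ x) 0 [0, a, b, c]) * 2 ^ x) 0 [0, a, b, c]) * 2 ^ x) 0 [0, a, b, c]) * 2 ^ x) 0 [0, a, b, c]) * 2 ^ x) 0 [0, a, b, c]) * 2 ^ x) 0 [0, a, b, c]) * 2 ^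 x) 0 [0, a, b, c]) * 2 ^ x) 0 [0, a, b, c] ||| List.foldr (fun (x acc : ℕ) => acc ||| (List.foldr (fun (x acc : ℕ) => acc ||| (List.foldr (fun (x acc : ℕ) => acc ||| (List.foldr (fun (x acc : ℕ) => acc ||| (List.foldr (fun (x acc : ℕ) => acc ||| (List.foldr (fun (x acc : ℕ) => acc ||| (List.foldr (fun (x acc : ℕ) => acc ||| (List.foldr (fun (x acc : ℕ) => acc ||| (List.foldr (fun (x acc : ℕ) => acc ||| (List.foldr (fun (x acc : ℕ) => acc ||| (List.foldr (fun (x acc : ℕ) => acc ||| (List.foldr (fun (y acc : ℕ) => acc ||| 2 ^ y) 0 [0, a, b, c]) * 2 ^ x) 0 [0, a, b, c]) * 2 ^ x) 0 [0, a, b, c]) * 2 ^ x) 0 [0, a, b, c]) * 2 ^ x) 0 [0, a, b, c]) * 2 ^ x) 0 [0, a, b, c]) * 2 ^ x) 0 [0, a, b, c]) * 2 ^ x) 0 [0, a, b, c]) * 2 ^ x) 0 [0, a, b, c]) * 2 ^ x) 0 [0, a, b, c]) * 2 ^ x) 0 [0, a, b, c]) * 2 ^ x) 0 [0, a, b, c]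 / 2) % 2 ^ (min 1416 (e - 1)) = 2 ^ (min 1416 (e - 1)) - 1) := by
    clear hfull pre3
    apply maskAlive_of_testBit
    intro r hr
    have hrT : r < 1416 := lt_of_lt_of_le hr (min_le_left _ _)
    have hrv : r < e - 1 := lt_of_lt_of_le hr (min_le_right _ _)
    have hr' : r + 1 < e := by omega
    have hrest : ∀ y ∈ [e], e ≤ y := by
      intro y hy
      simp only [List.mem_cons, List.mem_nil_iff, or_false] at hy
      omega
    rcases hchainP r (by omega) with h | h
    · exact Or.inl (testBit_fold12Shift_of_mem (memP12_prefix (l₁ := [0, a, b, c]) (l₂ := [e]) hrest (by omega) h))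
    · exact Or.inr (testBit_fold12Shift_of_mem (memP12_prefix (l₁ := [0, a, b, c]) (l₂ := [e]) hrest hr' h))
  obtain ⟨hnoT1, hnoT0T2⟩ :
      ((List.foldr (fun (x acc : ℕ) => acc ||| (List.foldr (fun (x acc : ℕ) => acc ||| (List.foldr (fun (x acc : ℕ) => acc ||| (List.foldr (fun (x acc : ℕ) => acc ||| (List.foldr (fun (x acc : ℕ) => acc ||| (List.foldr (fun (x acc : ℕ) => acc ||| (List.foldr (fun (x acc : ℕ) => acc ||| (List.foldr (fun (x acc : ℕ) => acc ||| (List.foldr (fun (x acc : ℕ) => acc ||| (List.foldr (fun (x acc : ℕ) => acc ||| (List.foldr (fun (x acc : ℕ) => acc ||| (List.foldr (fun (y acc : ℕ) => acc ||| 2 ^ y) 0 [0, a, b, c, e]) * 2 ^ x) 0 [0, a, b, c, e]) * 2 ^ x) 0 [0, a, b, c, e]) * 2 ^ x) 0 [0, a, b, c, e]) * 2 ^ x) 0 [0, a, b, c, e]) * 2 ^ x) 0 [0, a, b, c, e]) * 2 ^ x) 0 [0, a, b, c, e]) * 2 ^ x) 0 [0, a, b, c, e]) * 2 ^ x) 0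 [0, a, b, c, e]) * 2 ^ x) 0 [0, a, b, c, e]) * 2 ^ x) 0 [0, a, b, c, e]) * 2 ^ x) 0 [0, a, b, c, e]).testBit 1417 = false ∧ ((List.foldr (fun (x acc : ℕ) => acc ||| (List.foldr (fun (x acc : ℕ) => acc ||| (List.foldr (fun (x acc : ℕ) => acc ||| (List.foldr (fun (x acc : ℕ) => acc ||| (List.foldr (fun (x acc : ℕ) => acc ||| (List.foldr (fun (x acc : ℕ) => acc ||| (List.foldr (fun (x acc : ℕ) => acc ||| (List.foldr (fun (x acc : ℕ) => acc ||| (List.foldr (fun (x acc : ℕ) => acc ||| (List.foldr (fun (x acc : ℕ) => acc ||| (List.foldr (fun (x acc : ℕ) => acc ||| (List.foldr (fun (y acc : ℕ) => acc ||| 2 ^ y) 0 [0, a, b, c, e]) * 2 ^ x) 0 [0, a, b, c, e]) * 2 ^ x) 0 [0, a, b, c, e]) * 2 ^ x) 0 [0, a, b, c, e]) * 2 ^ x) 0 [0, a, b, c, e]) * 2 ^ x) 0 [0, a, b, c, e]) * 2 ^ x) 0 [0, a, b, c, e]) * 2 ^ x) 0 [0, a, b, c, e]) * 2 ^ x) 0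 [0, a, b, c, e]) * 2 ^ x) 0 [0, a, b, c, e]) * 2 ^ x) 0 [0, a, b, c, e]) * 2 ^ x) 0 [0, a, b, c, e]).testBit 1416 = false ∨ (List.foldr (fun (x acc : ℕ) => acc ||| (List.foldr (fun (x acc : ℕ) => acc ||| (List.foldr (fun (x acc : ℕ) => acc ||| (List.foldr (fun (x acc : ℕ) => acc ||| (List.foldr (fun (x acc : ℕ) => acc ||| (List.foldr (fun (x acc : ℕ) => acc ||| (List.foldr (fun (x acc : ℕ) => acc ||| (List.foldr (fun (x acc : ℕ) => acc ||| (List.foldr (fun (x acc : ℕ) => acc ||| (List.foldr (fun (x acc : ℕ) => acc ||| (List.foldr (fun (x acc : ℕ) => acc ||| (List.foldr (fun (y acc : ℕ) => acc ||| 2 ^ y) 0 [0, a, b, c, e]) * 2 ^ x) 0 [0, a, b, c, e]) * 2 ^ x) 0 [0, a, b, c, e]) * 2 ^ x) 0 [0, a, b, c, e]) * 2 ^ x) 0 [0, a, b, c, e]) * 2 ^ x) 0 [0, a, b, c, e]) * 2 ^ x) 0 [0, a, b, c, e]) * 2 ^ x) 0 [0, a, b, c, e]) * 2 ^ x) 0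 [0, a, b, c, e]) * 2 ^ x) 0 [0, a, b, c, e]) * 2 ^ x) 0 [0, a, b, c, e]) * 2 ^ x) 0 [0, a, b, c, e]).testBit 1418 = false)) := by
    interval_cases a <;> interval_cases b
    · exact sectorCheck_twelve_five_s12 c (hmemR c (by simp)) ⟨hlt2, pre3⟩ e (hmemR e (by simp)) ⟨hlt3, pre4⟩ hfull
    · exact sectorCheck_twelve_five_s13 c (hmemR c (by simp)) ⟨hlt2, pre3⟩ e (hmemR e (by simp)) ⟨hlt3, pre4⟩ hfull
    · exact sectorCheck_twelve_five_s14 c (hmemR c (by simp)) ⟨hlt2, pre3⟩ e (hmemR e (by simp)) ⟨hlt3, pre4⟩ hfull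
    · exact sectorCheck_twelve_five_s15 c (hmemR c (by simp)) ⟨hlt2, pre3⟩ e (hmemR e (by simp)) ⟨hlt3, pre4⟩ hfull
    · exact sectorCheck_twelve_five_s16 c (hmemR c (by simp)) ⟨hlt2, pre3⟩ e (hmemR e (by simp)) ⟨hlt3, pre4⟩ hfull
    · exact sectorCheck_twelve_five_s17 c (hmemR c (by simp)) ⟨hlt2, pre3⟩ e (hmemR e (by simp)) ⟨hlt3, pre4⟩ hfull
    · exact sectorCheck_twelve_five_s18 c (hmemR c (by simp)) ⟨hlt2, pre3⟩ e (hmemR e (by simp)) ⟨hlt3, pre4⟩ hfull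
    · exact sectorCheck_twelve_five_s19 c (hmemR c (by simp)) ⟨hlt2, pre3⟩ e (hmemR e (by simp)) ⟨hlt3, pre4⟩ hfull
    · exact sectorCheck_twelve_five_s110 c (hmemR c (by simp)) ⟨hlt2, pre3⟩ e (hmemR e (by simp)) ⟨hlt3, pre4⟩ hfull
    · exact sectorCheck_twelve_five_s111 c (hmemR c (by simp)) ⟨hlt2, pre3⟩ e (hmemR e (by simp)) ⟨hlt3, pre4⟩ hfull
    · exact sectorCheck_twelve_five_s112 c (hmemR c (by simp)) ⟨hlt2, pre3⟩ e (hmemR e (by simp)) ⟨hlt3, pre4⟩ hfull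
    · exact sectorCheck_twelve_five_s113 c (hmemR c (by simp)) ⟨hlt2, pre3⟩ e (hmemR e (by simp)) ⟨hlt3, pre4⟩ hfull
    · exact sectorCheck_twelve_five_s114 c (hmemR c (by simp)) ⟨hlt2, pre3⟩ e (hmemR e (by simp)) ⟨hlt3, pre4⟩ hfull
    · exact sectorCheck_twelve_five_s23 c (hmemR c (by simp)) ⟨hlt2, pre3⟩ e (hmemR e (by simp)) ⟨hlt3, pre4⟩ hfull
    · exact sectorCheck_twelve_five_s24 c (hmemR c (by simp)) ⟨hlt2, pre3⟩ e (hmemR e (by simp)) ⟨hlt3, pre4⟩ hfull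
    · exact sectorCheck_twelve_five_s25 c (hmemR c (by simp)) ⟨hlt2, pre3⟩ e (hmemR e (by simp)) ⟨hlt3, pre4⟩ hfull
    · exact sectorCheck_twelve_five_s26 c (hmemR c (by simp)) ⟨hlt2, pre3⟩ e (hmemR e (by simp)) ⟨hlt3, pre4⟩ hfull
    · exact sectorCheck_twelve_five_s27 c (hmemR c (by simp)) ⟨hlt2, pre3⟩ e (hmemR e (by simp)) ⟨hlt3, pre4⟩ hfull
    · exact sectorCheck_twelve_five_s28 c (hmemR c (by simp)) ⟨hlt2, pre3⟩ e (hmemR e (by simp)) ⟨hlt3, pre4⟩ hfull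
    · exact sectorCheck_twelve_five_s29 c (hmemR c (by simp)) ⟨hlt2, pre3⟩ e (hmemR e (by simp)) ⟨hlt3, pre4⟩ hfull
    · exact sectorCheck_twelve_five_s210 c (hmemR c (by simp)) ⟨hlt2, pre3⟩ e (hmemR e (by simp)) ⟨hlt3, pre4⟩ hfull
    · exact sectorCheck_twelve_five_s211 c (hmemR c (by simp)) ⟨hlt2, pre3⟩ e (hmemR e (by simp)) ⟨hlt3, pre4⟩ hfull
    · exact sectorCheck_twelve_five_s212 c (hmemR c (by simp)) ⟨hlt2, pre3⟩ e (hmemR e (by simp)) ⟨hlt3, pre4⟩ hfull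
    · exact sectorCheck_twelve_five_s213 c (hmemR c (by simp)) ⟨hlt2, pre3⟩ e (hmemR e (by simp)) ⟨hlt3, pre4⟩ hfull
    · exact sectorCheck_twelve_five_s214 c (hmemR c (by simp)) ⟨hlt2, pre3⟩ e (hmemR e (by simp)) ⟨hlt3, pre4⟩ hfull
    · exact sectorCheck_twelve_five_s215 c (hmemR c (by simp)) ⟨hlt2, pre3⟩ e (hmemR e (by simp)) ⟨hlt3, pre4⟩ hfull
    · exact sectorCheck_twelve_five_s216 c (hmemR c (by simp)) ⟨hlt2, pre3⟩ e (hmemR e (by simp)) ⟨hlt3, pre4⟩ hfull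
    · exact sectorCheck_twelve_five_s217 c (hmemR c (by simp)) ⟨hlt2, pre3⟩ e (hmemR e (by simp)) ⟨hlt3, pre4⟩ hfull
    · exact sectorCheck_twelve_five_s218 c (hmemR c (by simp)) ⟨hlt2, pre3⟩ e (hmemR e (by simp)) ⟨hlt3, pre4⟩ hfull
    · exact sectorCheck_twelve_five_s219 c (hmemR c (by simp)) ⟨hlt2, pre3⟩ e (hmemR e (by simp)) ⟨hlt3, pre4⟩ hfull
    · exact sectorCheck_twelve_five_s220 c (hmemR c (by simp)) ⟨hlt2, pre3⟩ e (hmemR e (by simp)) ⟨hlt3, pre4⟩ hfull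
    · exact sectorCheck_twelve_five_s221 c (hmemR c (by simp)) ⟨hlt2, pre3⟩ e (hmemR e (by simp)) ⟨hlt3, pre4⟩ hfull
    · exact sectorCheck_twelve_five_s222 c (hmemR c (by simp)) ⟨hlt2, pre3⟩ e (hmemR e (by simp)) ⟨hlt3, pre4⟩ hfull
    · exact sectorCheck_twelve_five_s223 c (hmemR c (by simp)) ⟨hlt2, pre3⟩ e (hmemR e (by simp)) ⟨hlt3, pre4⟩ hfull
    · exact sectorCheck_twelve_five_s224 c (hmemR c (by simp)) ⟨hlt2, pre3⟩ e (hmemR e (by simp)) ⟨hlt3, pre4⟩ hfull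
    · exact sectorCheck_twelve_five_s225 c (hmemR c (by simp)) ⟨hlt2, pre3⟩ e (hmemR e (by simp)) ⟨hlt3, pre4⟩ hfull
    · exact sectorCheck_twelve_five_s226 c (hmemR c (by simp)) ⟨hlt2, pre3⟩ e (hmemR e (by simp)) ⟨hlt3, pre4⟩ hfull
  -- the bitmask hypotheses are spent: drop them so that `omega` does not case-split on their `2^t - 1`
  clear hfull pre3 pre4
  have hcontra : ∀ r, r ≤ 1418 → (∃ i j k l n o q i₁ j₁ k₁ l₁ n₁ : Fin 5, d i + d j + d k + d l + d n + d o + d q + d i₁ + d j₁ + d k₁ + d l₁ + d n₁ = r) → (List.foldr (fun (x acc : ℕ) => acc ||| (List.foldr (fun (x acc : ℕ) => acc ||| (List.foldr (fun (x acc : ℕ) => acc ||| (List.foldr (fun (x acc : ℕ) => acc ||| (List.foldr (fun (x acc : ℕ) => acc ||| (List.foldr (fun (x acc : ℕ) => acc ||| (List.foldr (fun (x acc : ℕ) => acc ||| (List.foldr (fun (x acc : ℕ) => acc ||| (List.foldr (fun (x acc : ℕ) => acc ||| (List.foldr (fun (x acc : ℕ) => acc ||| (List.foldr (fun (x acc :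 ℕ) => acc ||| (List.foldr (fun (y acc : ℕ) => acc ||| 2 ^ y) 0 [0, a, b, c, e]) * 2 ^ x) 0 [0, a, b, c, e]) * 2 ^ x) 0 [0, a, b, c, e]) * 2 ^ x) 0 [0, a, b, c, e]) * 2 ^ x) 0 [0, a, b, c, e]) * 2 ^ x) 0 [0, a, b, c, e]) * 2 ^ x) 0 [0, a, b, c, e]) * 2 ^ x) 0 [0, a, b, c, e]) * 2 ^ x) 0 [0, a, b, c, e]) * 2 ^ x) 0 [0, a, b, c, e]) * 2 ^ x) 0 [0, a, b, c, e]) * 2 ^ x) 0 [0, a, b, c, e]).testBit r = false → False := by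
    intro r hr h hf
    have hb := testBit_fold12Shift_of_mem (hmemP r hr h)
    rw [hf] at hb
    exact Bool.false_ne_true hb
  rcases Nat.lt_or_ge (pencil d S).det.natDegree 1419 with hsmall | hbig
  · interval_cases h : (pencil d S).det.natDegree
    · exact hcontra 1417 (by clear * - h; omega) htop hnoT1
    · rcases hchain 1416 (by clear * - h; omega) with h' | h'
      · rcases hnoT0T2 with hf | hf
        · exact hcontra 1416 (by clear * - h; omega) h' hf
        · exact hcontra 1418 (by clear * - h; omega) htop hf
      · exact hcontra 1417 (by clear * - h; omega) h' hnoT1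
  · rcases hchain 1416 (by clear * - hbig; omega) with h1 | h1
    · rcases hchain 1417 (by clear * - hbig; omega) with h2 | h2
      · exact hcontra 1417 (by clear * - hbig; omega) h2 hnoT1
      · rcases hnoT0T2 with hf | hf
        · exact hcontra 1416 (by clear * - hbig; omega) h1 hf
        · exact hcontra 1418 (by clear * - hbig; omega) h2 hf
    · exact hcontra 1417 (by clear * - hbig; omega) h1 hnoT1

end Summit.ValiantsHypothesis.ValiantsHypothesis.Theorems.LacunarySymmetroidMatrixDescartes.FiniteSector
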